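import Summits.QuantumFields.BalabanUV.T4Continuum.Support.NE4ReadOutSocket
import Summits.QuantumFields.BalabanUV.T4Continuum.Support.OutputRateInsertion

/-!
# NE4ReadOutSocketInsertion — binder row NE4 (spine node U2) with row NE5's wall W4 PRODUCED: node U2's NE4 triple, its
# `InjectedRate` and the spine's `K`-uniform `URateUpTo K` from the two U3 rows' END theorems and the read-out (R), the
# history-insertion rate binder (`StepModel.InsertionRate`, wall W4 of row NE5) no longer posited but fed from W1's own
# entrywise binder through row NE5's `OutputRateInsertion` (same-data reading), BY NAME (cell `pub-balaban`, T⁴-continuum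
# fan-out, `HOME/BINDER-OWNERS.md` row NE4, owner lineage t4-ne4-p1, generation 30; sibling of `NE4ReadOutSocket` — that
# leaf stays byte-unchanged)

HONEST FRAMING (T4-DAG PAGE 1).  The cell's T⁴ target is rung (B)+1: existence AND uniqueness of the ε → 0 limit of
gauge-invariant observables on a FIXED finite torus T⁴ — NOT infinite volume, NOT a mass gap, NOT the Clay problem.  The
spine estimate NE4 («η-rate of the full β_k», shape `T4CouplingMatching.ScaleShiftRate`) is NOT PRINTED in
[Balaban1987RG1]–[Balaban1989LargeFieldII] (print bounds the SIZE of the new term of one renormalization step, never a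
modulus of continuity of the one-step map in the older terms; lineage record `t4/T4-EST-NE4-P1.md` §1 (S5)) and is NOT
PROVED here: node U2 is DEPENDENT — (R)∘{NE5, NE9} — and NE5, NE9 are the cell's own estimates, NOT PRINTED, NOT PROVED
(spine estimates proved: 0/9, unchanged by this module).  Nothing printed is asserted; no «…» quotation is introduced
(0 cite tags).  `FlowStep.BetaPertH`, (B), (B^μ) do not occur and are NOT hidden: they live in the window `W` / the runs of
whoever instantiates.  HONEST DEPENDENCY (cell, verbatim): continuum YM on T⁴ ⇐ BetaPertH ∧ nine spine estimates (0/9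
proved); BetaPertH ⇐ (D1) ∧ (D4) ∧ CAP+tail; G-an2-4 gates asym, D1 and NE2/3/4.

WHAT THIS MODULE IS.  `NE4ReadOutSocket` (generation 29, p202738) feeds row NE5's END theorem
`OutputRateResidual.ne5_at_of_entrywise_lip_nat` into node U2 with row NE5's wall W4 as the POSITED binder
`hinsf : ∀ b′ ∈ ]0, γ], (Mf b′).InsertionRate W κ E₀ δ₅ θ₁` (read-out family) / `hins : M.InsertionRate W κ E₀ δ₅ θ₁` (tower
pair).  Row NE5 (t4-ne5-p1, generation 25) has since PRODUCED W4 in `OutputRateInsertion` (p202795): under the same-data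
reading `InsOpModel.ofStep M Ins` (the insertion functional `Ins k : Op → table → Hist` read at the step model's OWN operator
data), `insertionRate_of_operatorRate` gives `InsertionRate κ E₀ (Gi·δ/(1 − ρ₁) + 2Gi/θ^{k₁}) θ` from `ReadsIns` ∧
`InsOpEnvelope κ E₀ Gi` ∧ `InsBoundA κ E₀ Gi` ∧ W1 `OperatorRate δ θ` ∧ the insertion reach `δθ^{k₁} ≤ ρ₁ < 1`, and W1 in
margin units is W1's entrywise binder (`OutputRateResidual.operatorRate_of_entrywise_floor`, `δ = c₁/r₀`).  This leaf
re-cuts node U2's three faces accordingly — each is the generation-29 theorem BY NAME with the W4 slot filled by that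
composition and the constant `δ₅ := Gi(c₁/r₀)/(1 − ρ₁) + 2Gi/θ₁^{k₁}` DISPLAYED (`hδ₅`):

* §1 `ne4_of_endNE9_endNE5_readsIns` — the row's TRIPLE `ScaleShiftRate (cr·C₅·θ₅) θ₅ γ β ∧ HistLipschitz (cr·Λ(·+1)) γ β ∧
  T4CouplingMatching.FadingMemory (cr·(ℓ/ν)·ν) ν (cr·Λ(·+1))` with, for the read-out family `Mf b′`, the W4 binder
  REPLACED by `ReadsIns` / `InsOpEnvelope κ E₀ Gi` / `InsBoundA κ E₀ Gi` of `InsOpModel.ofStep (Mf b′) (Insf b′)`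
  (datum-indexed insertion functionals, datum-FREE scalars `Gi`, `ρ₁`, `k₁`), `0 ≤ Gi`, `ρ₁ < 1`, the insertion reach
  `(c₁/r₀)·θ₁^{k₁} ≤ ρ₁`, and the STRICT sign `0 < θ₁` (the first-scales branch of the production divides by `θ₁^{k₁}`;
  generation 29 took `0 ≤ θ₁`).
* §2 `injectedRate_of_endNE9_endNE5_readsIns` — node U2's OUTPUT `InjectedRate (2(cr·C₅·θ₅)/(1 − ρ)) 0 ρ (disc of the runs)`
  by the gap route (NO asymptotic-freedom input), same replacement.
* §3 `uRateUpTo_of_endNE9_endNE5_readsIns` — the spine's `K`-UNIFORM `URateUpTo K` with the replacement on BOTH the tower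
  pair (`InsOpModel.ofStep M Ins`) and the read-out family.

WHAT REMAINS DISPLAYED AT NODE U2 after this leaf (booking sheet re-keyed; cf. `NE4ReadOutSocket`'s list): NOT PRINTED —
row NE9's majorant/two-point binders (`TwoPointKP`, `hCup`, `hTcup`, explicit-part modulus; PROOF-INTERIOR of (B) per row
NE9) and row NE5's walls W1 (entrywise = NE2 ∧ NE3, hence after G-an2-4) / W2 (`DataLipschitz`) / W2-ins (`InsOpEnvelope`:
a printed ONE-run analyticity re-read along a substituted operator deformation — NOT a cited fact under the cell's ABSOLUTE
RULE) / W3 / MI-R + `ReadsIns`; W4 is NO LONGER an independent η-rate input at node U2.  Printed STRUCTURE — `hA`/`hB`,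
`ScaleZeroFree`…`Factorises`, `hrepr`; printed TYPE, unprinted number — `cr`; node U1/H3 — runs/box/pin; CONDITIONAL-CELL —
(B)/(B^μ)/BetaPertH inside `W`; scalars — memory gap `ν < ρ`, the window, S `ω₅ + Λ₅c₅ < θ₅`, data reach `ρ₀` (`hnear`),
insertion reach `ρ₁`, one-run insertion level `Gi`.

WHAT IS PROVED: bookkeeping only (`subst` of the displayed abbreviation `δ₅`, one sign computation `0 ≤ δ₅`, the
generation-29 theorems BY NAME with `hinsf`/`hins :=` `OutputRateInsertion.insertionRate_of_operatorRate` ∘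
`OutputRateResidual.operatorRate_of_entrywise_floor`).  0 sorry; axioms ⊆ {propext, Classical.choice, Quot.sound}; imports
the LANDED modules `Support/NE4ReadOutSocket` (p202738) and `Support/OutputRateInsertion` (p202795) and modifies nothing of
them.  NOT COVERED: any instance of a binder for Bałaban's objects; NE2, NE3, NE5, NE9, BetaPertH, (B), (B^μ); the generic
insertion-operator species (`OutputRateInsertion.ne5_at_of_entrywise_lip_insOp_nat` with its own `InsOpRate δI θ`) — fed the
same way through `NE4ReadOutSocket` §1–§3 with `δ₅ := Gi·δI/(1 − ρ₁) + 2Gi/θ₁^{k₁}`, not restated.  Rung (B)+1 finite T⁴; NOT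
summit progress.
-/

namespace Summit.QuantumFields.BalabanUV.T4Continuum.NE4ReadOutSocketInsertion

open Literature.MathematicalPhysics.QuantumFieldTheory.Balaban1983to89
open FlowStep (HBeta RGEqH Box)
open T4OutputRate (Carriers Functional DecayBound LipBackground)
open T4CouplingMatching (disc ScaleShiftRate HistLipschitz)
open T4CauchySum (InjectedRate)
open T4EtaRateMin (Readings LocalRate)
open T4RateLiaison (GaugeDominated)
open T4TowerRateComposition (URateUpTo PolyLipGrowth)
open T4BetaReadOut (Slice ReadOut RepresentsA RepresentsB)
open T4BetaReadOutLipschitz (ReadBoundedOn ReadCovariantOn)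
open T4FlagMemory (extd)
open T4HistoryLipschitzRecursion (prodModuli ScaleZeroFree AdmissibleTerms AdmRestrict ChannelAdditive ChannelStepSum
  ChannelSizeAtStepNN)
open T4HistoryLipschitzOuter (Factorises)
open T4HistoryLipschitzActivity (ClusterGeom)
open T4HistoryLipschitzSegment (TwoPointKP)
open T4InputCauchyRateData (StepModel)
open T4OperatorRateLiaison (EntrywiseRate)
open OutputRateResidual (operatorRate_of_entrywise_floor)
open OutputRateInsertion (InsOpModel insertionRate_of_operatorRate)
open NE4ReadOutSocket (ne4_of_endNE9_endNE5 injectedRate_of_endNE9_endNE5 uRateUpTo_of_endNE9_endNE5)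

variable {C : Carriers} {ι X : Type}

/-! ## §0 The sign of the produced insertion constant -/

/-- The produced W4 constant `δ₅ = Gi(c₁/r₀)/(1 − ρ₁) + 2Gi/θ₁^{k₁}` is nonnegative for `0 ≤ Gi`, `0 ≤ c₁`, `0 < r₀`,
`ρ₁ < 1`, `0 < θ₁`. [folklore] -/
theorem insConst_nonneg {Gi c₁ r₀ ρ₁ θ₁ : ℝ} {k₁ : ℕ} (hGi : 0 ≤ Gi) (hc₁ : 0 ≤ c₁) (hr₀ : 0 < r₀) (hρ₁ : ρ₁ < 1)
    (hθ₁ : 0 < θ₁) : 0 ≤ Gi * (c₁ / r₀) / (1 - ρ₁) + 2 * Gi / θ₁ ^ k₁ :=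
  add_nonneg (div_nonneg (mul_nonneg hGi (div_nonneg hc₁ hr₀.le)) (by linarith))
    (div_nonneg (by positivity) (pow_pos hθ₁ k₁).le)

/-! ## §1 The row's triple at node U2, W4 produced on the read-out family -/

/-- **ROW NE4 — NODE U2's TRIPLE WITH ROW NE5's WALL W4 PRODUCED (read-out family, same-data reading), BY NAME.**  Binders:
(NE9-END) those of `NE9LastCouplingBridge.ne9_and_fadingMemory_of_couplingTwoPoint`, verbatim as in `NE4ReadOutSocket` §1,
`hℓ`/`hν` displayed.  (NE5-END, read-out family, W4 PRODUCED) for every datum `b′ ∈ ]0, γ]` through `Mf b′`: MI-R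
`hrAf`/`hrBf`/`hbasef`, W2 `hlipf`, decay `hdA`/`hdBf`, W1 entrywise `hentf`/`hunit`/`hflf`, W3 `hdampf`, and — in place of
the W4 binder — `hreadf` (`ReadsIns`), `hienvf` (`InsOpEnvelope κ E₀ Gi`), `hbdAf` (`InsBoundA κ E₀ Gi`) of
`InsOpModel.ofStep (Mf b′) (Insf b′)`, with datum-FREE scalars; `0 ≤ Gi`, `ρ₁ < 1`, insertion reach `hreach`, STRICT
`0 < θ₁`; data reach `hnear` and the constant `hC₅` at the produced `δ₅` (displayed, `hδ₅`); first scales `hfirst`;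
smallness S `hsmall5`.  (R) `hW`, `hA`, `hB`, `h𝒜A`, `h𝒜B`, `hr`, `hcov`, `hcr`.  Conclusion =
`NE4ReadOutSocket.ne4_of_endNE9_endNE5` with `hinsf := insertionRate_of_operatorRate ∘ operatorRate_of_entrywise_floor` per
datum. [folklore] -/
theorem ne4_of_endNE9_endNE5_readsIns (G : ClusterGeom C) {Pot : Type*} [NormedAddCommGroup Pot] [NormedSpace ℂ Pot]
    {S Hist : Type*} [Fintype S] [NormedAddCommGroup Hist] [NormedSpace ℂ Hist] [CompleteSpace Hist]
    (Mf : ℝ → StepModel C (S → ℂ) Hist) (Insf : ℝ → ℕ → (S → ℂ) → (C.Dom → ℝ) → Hist)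
    {ιc : Type} {EA : Functional C C.BgA} {W : Set (ℕ → ℝ)} {Adm : Set (C.BgA → C.Dom → ℝ)}
    {T : ℕ → (ℕ → ℝ) → (C.BgA → C.Dom → ℝ) → ιc → ℝ} {Ψ : ℕ → ℝ → (ιc → ℝ) → C.BgA → C.Dom → ℝ}
    {act : ℕ → ℝ → C.BgA → Pot → G.P → ℂ} {𝒜 : ℕ → Set Pot} {n : ℕ → ℝ → C.BgA → G.P → ℝ} {lip clip : ℕ → ℝ}
    {aP dP : G.P → ℝ} {δ : C.Dom → ℝ} {κ B lipbar clipbar pexbar qTbar τbar ω ℓ ν : ℝ} {wt : ℕ → ιc → ℝ}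
    {τ : ℕ → ℕ → ℝ} {pex qT : ℕ → ℝ} (ρT : ℕ → (ιc → ℝ) → Pot) (expl : ℕ → ℝ → C.BgA → C.Dom → ℝ)
    -- ===== row NE9's END theorem: the binders of `ne9_and_fadingMemory_of_couplingTwoPoint`, verbatim =====
    (h0 : ScaleZeroFree EA W) (hAdm : AdmissibleTerms EA W Adm) (hres : AdmRestrict Adm) (hadd : ChannelAdditive Adm T)
    (hsum : ChannelStepSum Adm T) (hstep : ChannelSizeAtStepNN Adm T κ wt τ) (hfac : Factorises EA W T Ψ)
    (hclip0 : ∀ k, 0 ≤ clip k)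
    (hCup : ∀ g ∈ W, ∀ g' ∈ W, ∀ (k : ℕ) (U : C.BgA) (X : C.Dom), C.scale X = k + 1 → ∀ Q ∈ 𝒜 k, ∀ γ ∈ G.vol X,
      ‖act k (g k) U Q γ‖ ≤ n k (g' k) U γ ∧
        ‖act k (g k) U Q γ - act k (g' k) U Q γ‖ ≤ clip k * |g k - g' k| * n k (g' k) U γ)
    (hqT0 : ∀ k, 0 ≤ qT k)
    (hTcup : ∀ g ∈ W, ∀ g' ∈ W, ∀ (k : ℕ) (y : ιc), |T k g (EA g) y - T k g' (EA g) y| ≤ wt k y * (qT k * |g k - g' k|))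
    (hrepr : ∀ (k : ℕ) (s : ℝ) (P : ιc → ℝ) (U : C.BgA) (X : C.Dom),
      Ψ k s P U X = (G.newTerm act k s U X (ρT k P)).re + expl k s U X)
    (hexpl : ∀ g ∈ W, ∀ g' ∈ W, ∀ (k : ℕ) (U : C.BgA) (X : C.Dom), C.scale X = k + 1 →
      |expl k (g k) U X - expl k (g' k) U X| ≤ Real.exp (-(κ * C.d X)) * (pex k * |g k - g' k|))
    (hclipb : ∀ k, clip k ≤ clipbar) (hpexb : ∀ k, pex k ≤ pexbar) (hpexbar : 0 ≤ pexbar) (hqTb : ∀ k, qT k ≤ qTbar)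
    (hKP : TwoPointKP G W act 𝒜 n lip aP dP) (hdec : G.DecayExtract δ dP) (hpinB : G.PinBudget aP δ (fun _ => B) κ)
    (hρT : ∀ (k : ℕ) (P P' : ιc → ℝ) (M : ℝ), (∀ y, |P y - P' y| ≤ wt k y * M) → ‖ρT k P - ρT k P'‖ ≤ M)
    (hocc : ∀ g ∈ W, ∀ g' ∈ W, ∀ k : ℕ, ρT k (T k g' (EA g)) ∈ 𝒜 k) (hB0 : 0 ≤ B)
    (hlipb : ∀ k, lip k ≤ lipbar) (hτbar : 0 ≤ τbar) (hω : 0 ≤ ω) (hpos : 0 < ω + 4 * lipbar * B * τbar)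
    (hτ : ∀ k j, j ≤ k → 0 ≤ τ k j ∧ τ k j ≤ τbar * ω ^ (k - j))
    (hℓ : 4 * clipbar * B + pexbar + 4 * lipbar * B * qTbar = ℓ) (hν : ω + 4 * lipbar * B * τbar = ν)
    -- ===== row NE5's END theorem for the read-out family, wall W4 PRODUCED (same-data reading), datum-free scalars =====
    {EBfam : ℝ → Functional C C.BgB} {γ Λ₅ EA₀ E₀ c₁ r₀ Gi ρ₁ δ₅ θ₁ θ₅ c₅ ω₅ ρ₀ B₅ C₅ : ℝ} {rf : ℕ → S → ℝ}
    {k₅ k₁ : ℕ}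
    (hdA : DecayBound EA W EA₀ κ) (hunit : ∀ k s, rf k s ≤ θ₁ ^ k) (hr₀ : 0 < r₀) (hc₁ : 0 ≤ c₁)
    (hrAf : ∀ b', 0 < b' → b' ≤ γ → (Mf b').RepresentsA EA W)
    (hrBf : ∀ b', 0 < b' → b' ≤ γ → (Mf b').RepresentsB (EBfam b') W)
    (hbasef : ∀ b', 0 < b' → b' ≤ γ → (Mf b').InBase (EBfam b') W)
    (hlipf : ∀ b', 0 < b' → b' ≤ γ → (Mf b').DataLipschitz W κ Λ₅ ρ₀)
    (hdBf : ∀ b', 0 < b' → b' ≤ γ → DecayBound (EBfam b') W E₀ κ)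
    (hentf : ∀ b', 0 < b' → b' ≤ γ → EntrywiseRate (Mf b') W c₁ rf)
    (hflf : ∀ b', 0 < b' → b' ≤ γ → ∀ k, r₀ ≤ (Mf b').rOp k)
    (hreadf : ∀ b', 0 < b' → b' ≤ γ → (InsOpModel.ofStep (Mf b') (Insf b')).ReadsIns W)
    (hienvf : ∀ b', 0 < b' → b' ≤ γ → (InsOpModel.ofStep (Mf b') (Insf b')).InsOpEnvelope W κ E₀ Gi)
    (hbdAf : ∀ b', 0 < b' → b' ≤ γ → (InsOpModel.ofStep (Mf b') (Insf b')).InsBoundA W κ E₀ Gi)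
    (hGi : 0 ≤ Gi) (hρ₁ : ρ₁ < 1) (hreach : c₁ / r₀ * θ₁ ^ k₁ ≤ ρ₁)
    (hδ₅ : Gi * (c₁ / r₀) / (1 - ρ₁) + 2 * Gi / θ₁ ^ k₁ = δ₅)
    (hdampf : ∀ b', 0 < b' → b' ≤ γ → (Mf b').InsertionDampedNat W κ c₅ ω₅)
    (hΛ₅ : 0 ≤ Λ₅) (hθ₁ : 0 < θ₁) (hθ₁₅ : θ₁ ≤ θ₅) (hθ₅1 : θ₅ ≤ 1) (hc₅ : 0 ≤ c₅) (hω₅ : 0 < ω₅)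
    (hnear : (c₁ / r₀ + δ₅) * θ₁ ^ k₅ + c₅ * (EA₀ + E₀) / (1 - ω₅) ≤ ρ₀) (hB₅ : 0 ≤ B₅)
    (hfirst : ∀ k < k₅, EA₀ + E₀ ≤ B₅ * θ₁ ^ k) (hsmall5 : ω₅ + Λ₅ * c₅ < θ₅)
    (hC₅ : (Λ₅ * (c₁ / r₀ + δ₅) + B₅) * (θ₅ - ω₅) / (θ₅ - (ω₅ + Λ₅ * c₅)) = C₅)
    -- ===== node U2's read-out (R) =====
    {𝒜A : Set (Slice C C.BgA)} {𝒜B : Set (Slice C C.BgB)} {rA : ReadOut C C.BgA} {rB : ReadOut C C.BgB} {β : HBeta}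
    {cr : ℝ} (hW : ∀ k (v : Fin (k + 1) → ℝ), v ∈ Box γ k → extd v ∈ W)
    (hA : RepresentsA EA rA γ β) (hB : RepresentsB EBfam rB γ β)
    (h𝒜A : ∀ g' ∈ W, EA g' ∈ 𝒜A) (h𝒜B : ∀ b', 0 < b' → b' ≤ γ → ∀ g' ∈ W, EBfam b' g' ∈ 𝒜B)
    (hr : ReadBoundedOn 𝒜A rA κ cr) (hcov : ReadCovariantOn 𝒜A 𝒜B rA rB κ cr) (hcr : 0 ≤ cr) :
    ScaleShiftRate (cr * C₅ * θ₅) θ₅ γ β ∧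
      HistLipschitz (fun k i => cr * prodModuli ℓ (fun _ => ν) (k + 1) i) γ β ∧
        T4CouplingMatching.FadingMemory (cr * (ℓ / ν) * ν) ν (fun k i => cr * prodModuli ℓ (fun _ => ν) (k + 1) i) := by
  subst hδ₅
  exact ne4_of_endNE9_endNE5 G Mf ρT expl h0 hAdm hres hadd hsum hstep hfac hclip0 hCup hqT0 hTcup hrepr hexpl hclipb hpexb
    hpexbar hqTb hKP hdec hpinB hρT hocc hB0 hlipb hτbar hω hpos hτ hℓ hν hdA hunit hr₀ hc₁ hrAf hrBf hbasef hlipf hdBf hentf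
    hflf
    (fun b' hb hbγ => insertionRate_of_operatorRate (Mf b') (Insf b') (hreadf b' hb hbγ) (hienvf b' hb hbγ) (hbdAf b' hb hbγ)
      (operatorRate_of_entrywise_floor (Mf b') (hentf b' hb hbγ) hunit (hflf b' hb hbγ) hr₀ hc₁ hθ₁.le)
      (div_nonneg hc₁ hr₀.le) hθ₁ (hθ₁₅.trans hθ₅1) hρ₁ hreach)
    hdampf hΛ₅ (insConst_nonneg hGi hc₁ hr₀ hρ₁ hθ₁) hθ₁.le hθ₁₅ hθ₅1 hc₅ hω₅ hnear hB₅ hfirst hsmall5 hC₅ hW hA hB h𝒜A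
    h𝒜B hr hcov hcr

/-! ## §2 Node U2's output in the spine's currency, W4 produced (gap route, no asymptotic-freedom input) -/

/-- **ROW NE4 — NODE U2's OUTPUT `InjectedRate` WITH W4 PRODUCED, BY NAME.**  §1's binders plus node U1/H3's runs of
(0.20) with history (`hrun`), the printed box (`hbox`), the infrared pin (`hpin`), `θ₅ ≤ ρ`, memory gap `ν < ρ`,
`0 < ρ < 1`, `0 ≤ γ`, the window `hsmall`; conclusion = `NE4ReadOutSocket.injectedRate_of_endNE9_endNE5` (t4-ne9-p1's
GAP-ONLY closure `T4CurrencyMatching.injectedRate_of_runs_gap` on §1's triple): `InjectedRate (2(cr·C₅·θ₅)/(1 − ρ)) 0 ρ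
(disc of the runs)`.  NO `EventualLowerH`, NO `0 < b`. [folklore] -/
theorem injectedRate_of_endNE9_endNE5_readsIns (G : ClusterGeom C) {Pot : Type*} [NormedAddCommGroup Pot]
    [NormedSpace ℂ Pot] {S Hist : Type*} [Fintype S] [NormedAddCommGroup Hist] [NormedSpace ℂ Hist] [CompleteSpace Hist]
    (Mf : ℝ → StepModel C (S → ℂ) Hist) (Insf : ℝ → ℕ → (S → ℂ) → (C.Dom → ℝ) → Hist)
    {ιc : Type} {EA : Functional C C.BgA} {W : Set (ℕ → ℝ)} {Adm : Set (C.BgA → C.Dom → ℝ)}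
    {T : ℕ → (ℕ → ℝ) → (C.BgA → C.Dom → ℝ) → ιc → ℝ} {Ψ : ℕ → ℝ → (ιc → ℝ) → C.BgA → C.Dom → ℝ}
    {act : ℕ → ℝ → C.BgA → Pot → G.P → ℂ} {𝒜 : ℕ → Set Pot} {n : ℕ → ℝ → C.BgA → G.P → ℝ} {lip clip : ℕ → ℝ}
    {aP dP : G.P → ℝ} {δ : C.Dom → ℝ} {κ B lipbar clipbar pexbar qTbar τbar ω ℓ ν : ℝ} {wt : ℕ → ιc → ℝ}
    {τ : ℕ → ℕ → ℝ} {pex qT : ℕ → ℝ} (ρT : ℕ → (ιc → ℝ) → Pot) (expl : ℕ → ℝ → C.BgA → C.Dom → ℝ)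
    (h0 : ScaleZeroFree EA W) (hAdm : AdmissibleTerms EA W Adm) (hres : AdmRestrict Adm) (hadd : ChannelAdditive Adm T)
    (hsum : ChannelStepSum Adm T) (hstep : ChannelSizeAtStepNN Adm T κ wt τ) (hfac : Factorises EA W T Ψ)
    (hclip0 : ∀ k, 0 ≤ clip k)
    (hCup : ∀ g ∈ W, ∀ g' ∈ W, ∀ (k : ℕ) (U : C.BgA) (X : C.Dom), C.scale X = k + 1 → ∀ Q ∈ 𝒜 k, ∀ γ ∈ G.vol X,
      ‖act k (g k) U Q γ‖ ≤ n k (g' k) U γ ∧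
        ‖act k (g k) U Q γ - act k (g' k) U Q γ‖ ≤ clip k * |g k - g' k| * n k (g' k) U γ)
    (hqT0 : ∀ k, 0 ≤ qT k)
    (hTcup : ∀ g ∈ W, ∀ g' ∈ W, ∀ (k : ℕ) (y : ιc), |T k g (EA g) y - T k g' (EA g) y| ≤ wt k y * (qT k * |g k - g' k|))
    (hrepr : ∀ (k : ℕ) (s : ℝ) (P : ιc → ℝ) (U : C.BgA) (X : C.Dom),
      Ψ k s P U X = (G.newTerm act k s U X (ρT k P)).re + expl k s U X)
    (hexpl : ∀ g ∈ W, ∀ g' ∈ W, ∀ (k : ℕ) (U : C.BgA) (X : C.Dom), C.scale X = k + 1 →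
      |expl k (g k) U X - expl k (g' k) U X| ≤ Real.exp (-(κ * C.d X)) * (pex k * |g k - g' k|))
    (hclipb : ∀ k, clip k ≤ clipbar) (hpexb : ∀ k, pex k ≤ pexbar) (hpexbar : 0 ≤ pexbar) (hqTb : ∀ k, qT k ≤ qTbar)
    (hKP : TwoPointKP G W act 𝒜 n lip aP dP) (hdec : G.DecayExtract δ dP) (hpinB : G.PinBudget aP δ (fun _ => B) κ)
    (hρT : ∀ (k : ℕ) (P P' : ιc → ℝ) (M : ℝ), (∀ y, |P y - P' y| ≤ wt k y * M) → ‖ρT k P - ρT k P'‖ ≤ M)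
    (hocc : ∀ g ∈ W, ∀ g' ∈ W, ∀ k : ℕ, ρT k (T k g' (EA g)) ∈ 𝒜 k) (hB0 : 0 ≤ B)
    (hlipb : ∀ k, lip k ≤ lipbar) (hτbar : 0 ≤ τbar) (hω : 0 ≤ ω) (hpos : 0 < ω + 4 * lipbar * B * τbar)
    (hτ : ∀ k j, j ≤ k → 0 ≤ τ k j ∧ τ k j ≤ τbar * ω ^ (k - j))
    (hℓ : 4 * clipbar * B + pexbar + 4 * lipbar * B * qTbar = ℓ) (hν : ω + 4 * lipbar * B * τbar = ν)
    {EBfam : ℝ → Functional C C.BgB} {γ Λ₅ EA₀ E₀ c₁ r₀ Gi ρ₁ δ₅ θ₁ θ₅ c₅ ω₅ ρ₀ B₅ C₅ : ℝ} {rf : ℕ → S → ℝ}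
    {k₅ k₁ : ℕ}
    (hdA : DecayBound EA W EA₀ κ) (hunit : ∀ k s, rf k s ≤ θ₁ ^ k) (hr₀ : 0 < r₀) (hc₁ : 0 ≤ c₁)
    (hrAf : ∀ b', 0 < b' → b' ≤ γ → (Mf b').RepresentsA EA W)
    (hrBf : ∀ b', 0 < b' → b' ≤ γ → (Mf b').RepresentsB (EBfam b') W)
    (hbasef : ∀ b', 0 < b' → b' ≤ γ → (Mf b').InBase (EBfam b') W)
    (hlipf : ∀ b', 0 < b' → b' ≤ γ → (Mf b').DataLipschitz W κ Λ₅ ρ₀)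
    (hdBf : ∀ b', 0 < b' → b' ≤ γ → DecayBound (EBfam b') W E₀ κ)
    (hentf : ∀ b', 0 < b' → b' ≤ γ → EntrywiseRate (Mf b') W c₁ rf)
    (hflf : ∀ b', 0 < b' → b' ≤ γ → ∀ k, r₀ ≤ (Mf b').rOp k)
    (hreadf : ∀ b', 0 < b' → b' ≤ γ → (InsOpModel.ofStep (Mf b') (Insf b')).ReadsIns W)
    (hienvf : ∀ b', 0 < b' → b' ≤ γ → (InsOpModel.ofStep (Mf b') (Insf b')).InsOpEnvelope W κ E₀ Gi)
    (hbdAf : ∀ b', 0 < b' → b' ≤ γ → (InsOpModel.ofStep (Mf b') (Insf b')).InsBoundA W κ E₀ Gi)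
    (hGi : 0 ≤ Gi) (hρ₁ : ρ₁ < 1) (hreach : c₁ / r₀ * θ₁ ^ k₁ ≤ ρ₁)
    (hδ₅ : Gi * (c₁ / r₀) / (1 - ρ₁) + 2 * Gi / θ₁ ^ k₁ = δ₅)
    (hdampf : ∀ b', 0 < b' → b' ≤ γ → (Mf b').InsertionDampedNat W κ c₅ ω₅)
    (hΛ₅ : 0 ≤ Λ₅) (hθ₁ : 0 < θ₁) (hθ₁₅ : θ₁ ≤ θ₅) (hθ₅1 : θ₅ ≤ 1) (hc₅ : 0 ≤ c₅) (hω₅ : 0 < ω₅)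
    (hnear : (c₁ / r₀ + δ₅) * θ₁ ^ k₅ + c₅ * (EA₀ + E₀) / (1 - ω₅) ≤ ρ₀) (hB₅ : 0 ≤ B₅)
    (hfirst : ∀ k < k₅, EA₀ + E₀ ≤ B₅ * θ₁ ^ k) (hsmall5 : ω₅ + Λ₅ * c₅ < θ₅)
    (hC₅ : (Λ₅ * (c₁ / r₀ + δ₅) + B₅) * (θ₅ - ω₅) / (θ₅ - (ω₅ + Λ₅ * c₅)) = C₅)
    {𝒜A : Set (Slice C C.BgA)} {𝒜B : Set (Slice C C.BgB)} {rA : ReadOut C C.BgA} {rB : ReadOut C C.BgB} {β : HBeta}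
    {cr : ℝ} (hW : ∀ k (v : Fin (k + 1) → ℝ), v ∈ Box γ k → extd v ∈ W)
    (hA : RepresentsA EA rA γ β) (hB : RepresentsB EBfam rB γ β)
    (h𝒜A : ∀ g' ∈ W, EA g' ∈ 𝒜A) (h𝒜B : ∀ b', 0 < b' → b' ≤ γ → ∀ g' ∈ W, EBfam b' g' ∈ 𝒜B)
    (hr : ReadBoundedOn 𝒜A rA κ cr) (hcov : ReadCovariantOn 𝒜A 𝒜B rA rB κ cr) (hcr : 0 ≤ cr)
    -- ===== node U1/H3's runs, the rates and the window =====
    {ρ : ℝ} (g : ℕ → ℕ → ℝ) (gIR : ℝ) (hθ₅ρ : θ₅ ≤ ρ) (hνρ : ν < ρ) (hρ0 : 0 < ρ) (hρ1 : ρ < 1) (hγ : 0 ≤ γ)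
    (hrun : ∀ K, RGEqH K β (g K)) (hbox : ∀ K i, i ≤ K → 0 < g K i ∧ g K i ≤ γ) (hpin : ∀ K, g K K = gIR)
    (hsmall : cr * (ℓ / ν) * ν * (γ ^ 3 / 2) * (ρ / (ρ - ν)) ≤ (1 - ρ) / 2) :
    InjectedRate (2 * (cr * C₅ * θ₅) / (1 - ρ)) 0 ρ (fun K j => disc (g K) (g (K + 1)) j) := by
  subst hδ₅
  exact injectedRate_of_endNE9_endNE5 G Mf ρT expl h0 hAdm hres hadd hsum hstep hfac hclip0 hCup hqT0 hTcup hrepr hexpl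
    hclipb hpexb hpexbar hqTb hKP hdec hpinB hρT hocc hB0 hlipb hτbar hω hpos hτ hℓ hν hdA hunit hr₀ hc₁ hrAf hrBf hbasef
    hlipf hdBf hentf hflf
    (fun b' hb hbγ => insertionRate_of_operatorRate (Mf b') (Insf b') (hreadf b' hb hbγ) (hienvf b' hb hbγ) (hbdAf b' hb hbγ)
      (operatorRate_of_entrywise_floor (Mf b') (hentf b' hb hbγ) hunit (hflf b' hb hbγ) hr₀ hc₁ hθ₁.le)
      (div_nonneg hc₁ hr₀.le) hθ₁ (hθ₁₅.trans hθ₅1) hρ₁ hreach)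
    hdampf hΛ₅ (insConst_nonneg hGi hc₁ hr₀ hρ₁ hθ₁) hθ₁.le hθ₁₅ hθ₅1 hc₅ hω₅ hnear hB₅ hfirst hsmall5 hC₅ hW hA hB h𝒜A
    h𝒜B hr hcov hcr g gIR hθ₅ρ hνρ hρ0 hρ1 hγ hrun hbox hpin hsmall

/-! ## §3 The spine's `K`-uniform term-wise matching, W4 produced on the tower pair and on the read-out family -/

/-- **ROW NE4 IN THE SPINE — `URateUpTo K`, `K`-UNIFORM, WITH W4 PRODUCED ON BOTH STEP MODELS, BY NAME.**
`NE4ReadOutSocket.uRateUpTo_of_endNE9_endNE5` with: the tower pair (`EA`, `EB`) through ONE step model `M` whose W4 binder is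
REPLACED by `ReadsIns`/`InsOpEnvelope κ E₀ Gi`/`InsBoundA κ E₀ Gi` of `InsOpModel.ofStep M Ins` (`hread`/`hienv`/`hbdA`); the
read-out family as in §1; the shared datum-free scalars `Gi`, `ρ₁`, `k₁`, `δ₅` (displayed); `hinj := §2`'s route inside;
node U1b `hU`/`hG`/`hP`; nodes U5/U6 `hloc`/`hgd`; the runs in `W`; target rate `θ′ > max ν ρ`.  Constant
`a + (ℓ/ν)·(γ³·2(cr·C₅·θ₅)/(1 − ρ))·θ′/(θ′ − max ν ρ) + C₅`. [folklore] -/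
theorem uRateUpTo_of_endNE9_endNE5_readsIns (G : ClusterGeom C) {Pot : Type*} [NormedAddCommGroup Pot]
    [NormedSpace ℂ Pot] {S Hist : Type*} [Fintype S] [NormedAddCommGroup Hist] [NormedSpace ℂ Hist] [CompleteSpace Hist]
    (M : StepModel C (S → ℂ) Hist) (Ins : ℕ → (S → ℂ) → (C.Dom → ℝ) → Hist) (Mf : ℝ → StepModel C (S → ℂ) Hist)
    (Insf : ℝ → ℕ → (S → ℂ) → (C.Dom → ℝ) → Hist) {ιc : Type} {EA : Functional C C.BgA} {W : Set (ℕ → ℝ)}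
    {Adm : Set (C.BgA → C.Dom → ℝ)} {T : ℕ → (ℕ → ℝ) → (C.BgA → C.Dom → ℝ) → ιc → ℝ}
    {Ψ : ℕ → ℝ → (ιc → ℝ) → C.BgA → C.Dom → ℝ} {act : ℕ → ℝ → C.BgA → Pot → G.P → ℂ} {𝒜 : ℕ → Set Pot}
    {n : ℕ → ℝ → C.BgA → G.P → ℝ} {lip clip : ℕ → ℝ} {aP dP : G.P → ℝ} {δ : C.Dom → ℝ}
    {κ B lipbar clipbar pexbar qTbar τbar ω ℓ ν : ℝ} {wt : ℕ → ιc → ℝ} {τ : ℕ → ℕ → ℝ} {pex qT : ℕ → ℝ}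
    (ρT : ℕ → (ιc → ℝ) → Pot) (expl : ℕ → ℝ → C.BgA → C.Dom → ℝ)
    -- ===== row NE9's END theorem =====
    (h0 : ScaleZeroFree EA W) (hAdm : AdmissibleTerms EA W Adm) (hres : AdmRestrict Adm) (hadd : ChannelAdditive Adm T)
    (hsum : ChannelStepSum Adm T) (hstep : ChannelSizeAtStepNN Adm T κ wt τ) (hfac : Factorises EA W T Ψ)
    (hclip0 : ∀ k, 0 ≤ clip k)
    (hCup : ∀ g ∈ W, ∀ g' ∈ W, ∀ (k : ℕ) (U : C.BgA) (X : C.Dom), C.scale X = k + 1 → ∀ Q ∈ 𝒜 k, ∀ γ ∈ G.vol X,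
      ‖act k (g k) U Q γ‖ ≤ n k (g' k) U γ ∧
        ‖act k (g k) U Q γ - act k (g' k) U Q γ‖ ≤ clip k * |g k - g' k| * n k (g' k) U γ)
    (hqT0 : ∀ k, 0 ≤ qT k)
    (hTcup : ∀ g ∈ W, ∀ g' ∈ W, ∀ (k : ℕ) (y : ιc), |T k g (EA g) y - T k g' (EA g) y| ≤ wt k y * (qT k * |g k - g' k|))
    (hrepr : ∀ (k : ℕ) (s : ℝ) (P : ιc → ℝ) (U : C.BgA) (X : C.Dom),
      Ψ k s P U X = (G.newTerm act k s U X (ρT k P)).re + expl k s U X)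
    (hexpl : ∀ g ∈ W, ∀ g' ∈ W, ∀ (k : ℕ) (U : C.BgA) (X : C.Dom), C.scale X = k + 1 →
      |expl k (g k) U X - expl k (g' k) U X| ≤ Real.exp (-(κ * C.d X)) * (pex k * |g k - g' k|))
    (hclipb : ∀ k, clip k ≤ clipbar) (hpexb : ∀ k, pex k ≤ pexbar) (hpexbar : 0 ≤ pexbar) (hqTb : ∀ k, qT k ≤ qTbar)
    (hKP : TwoPointKP G W act 𝒜 n lip aP dP) (hdec : G.DecayExtract δ dP) (hpinB : G.PinBudget aP δ (fun _ => B) κ)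
    (hρT : ∀ (k : ℕ) (P P' : ιc → ℝ) (M : ℝ), (∀ y, |P y - P' y| ≤ wt k y * M) → ‖ρT k P - ρT k P'‖ ≤ M)
    (hocc : ∀ g ∈ W, ∀ g' ∈ W, ∀ k : ℕ, ρT k (T k g' (EA g)) ∈ 𝒜 k) (hB0 : 0 ≤ B)
    (hlipb : ∀ k, lip k ≤ lipbar) (hτbar : 0 ≤ τbar) (hω : 0 ≤ ω) (hpos : 0 < ω + 4 * lipbar * B * τbar)
    (hτ : ∀ k j, j ≤ k → 0 ≤ τ k j ∧ τ k j ≤ τbar * ω ^ (k - j))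
    (hℓ : 4 * clipbar * B + pexbar + 4 * lipbar * B * qTbar = ℓ) (hν : ω + 4 * lipbar * B * τbar = ν)
    -- ===== row NE5's END theorem, W4 PRODUCED: tower pair via `M`/`Ins`, read-out family via `Mf b′`/`Insf b′` =====
    {EB : Functional C C.BgB} {EBfam : ℝ → Functional C C.BgB}
    {γ Λ₅ EA₀ E₀ c₁ r₀ Gi ρ₁ δ₅ θ₁ θ₅ c₅ ω₅ ρ₀ B₅ C₅ : ℝ} {rf : ℕ → S → ℝ} {k₅ k₁ : ℕ}
    (hrA : M.RepresentsA EA W) (hrB : M.RepresentsB EB W) (hbase : M.InBase EB W) (hlip5 : M.DataLipschitz W κ Λ₅ ρ₀)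
    (hdA : DecayBound EA W EA₀ κ) (hdB : DecayBound EB W E₀ κ) (hent : EntrywiseRate M W c₁ rf)
    (hunit : ∀ k s, rf k s ≤ θ₁ ^ k) (hfl : ∀ k, r₀ ≤ M.rOp k) (hr₀ : 0 < r₀) (hc₁ : 0 ≤ c₁)
    (hread : (InsOpModel.ofStep M Ins).ReadsIns W) (hienv : (InsOpModel.ofStep M Ins).InsOpEnvelope W κ E₀ Gi)
    (hbdA : (InsOpModel.ofStep M Ins).InsBoundA W κ E₀ Gi) (hdamp : M.InsertionDampedNat W κ c₅ ω₅)
    (hrAf : ∀ b', 0 < b' → b' ≤ γ → (Mf b').RepresentsA EA W)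
    (hrBf : ∀ b', 0 < b' → b' ≤ γ → (Mf b').RepresentsB (EBfam b') W)
    (hbasef : ∀ b', 0 < b' → b' ≤ γ → (Mf b').InBase (EBfam b') W)
    (hlipf : ∀ b', 0 < b' → b' ≤ γ → (Mf b').DataLipschitz W κ Λ₅ ρ₀)
    (hdBf : ∀ b', 0 < b' → b' ≤ γ → DecayBound (EBfam b') W E₀ κ)
    (hentf : ∀ b', 0 < b' → b' ≤ γ → EntrywiseRate (Mf b') W c₁ rf)
    (hflf : ∀ b', 0 < b' → b' ≤ γ → ∀ k, r₀ ≤ (Mf b').rOp k)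
    (hreadf : ∀ b', 0 < b' → b' ≤ γ → (InsOpModel.ofStep (Mf b') (Insf b')).ReadsIns W)
    (hienvf : ∀ b', 0 < b' → b' ≤ γ → (InsOpModel.ofStep (Mf b') (Insf b')).InsOpEnvelope W κ E₀ Gi)
    (hbdAf : ∀ b', 0 < b' → b' ≤ γ → (InsOpModel.ofStep (Mf b') (Insf b')).InsBoundA W κ E₀ Gi)
    (hGi : 0 ≤ Gi) (hρ₁ : ρ₁ < 1) (hreach : c₁ / r₀ * θ₁ ^ k₁ ≤ ρ₁)
    (hδ₅ : Gi * (c₁ / r₀) / (1 - ρ₁) + 2 * Gi / θ₁ ^ k₁ = δ₅)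
    (hdampf : ∀ b', 0 < b' → b' ≤ γ → (Mf b').InsertionDampedNat W κ c₅ ω₅)
    (hΛ₅ : 0 ≤ Λ₅) (hθ₁ : 0 < θ₁) (hθ₁₅ : θ₁ ≤ θ₅) (hθ₅1 : θ₅ ≤ 1) (hc₅ : 0 ≤ c₅) (hω₅ : 0 < ω₅)
    (hnear : (c₁ / r₀ + δ₅) * θ₁ ^ k₅ + c₅ * (EA₀ + E₀) / (1 - ω₅) ≤ ρ₀) (hB₅ : 0 ≤ B₅)
    (hfirst : ∀ k < k₅, EA₀ + E₀ ≤ B₅ * θ₁ ^ k) (hsmall5 : ω₅ + Λ₅ * c₅ < θ₅)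
    (hC₅ : (Λ₅ * (c₁ / r₀ + δ₅) + B₅) * (θ₅ - ω₅) / (θ₅ - (ω₅ + Λ₅ * c₅)) = C₅)
    -- ===== node U2's read-out (R) =====
    {𝒜A : Set (Slice C C.BgA)} {𝒜B : Set (Slice C C.BgB)} {rA : ReadOut C C.BgA} {rB : ReadOut C C.BgB} {β : HBeta}
    {cr : ℝ} (hW : ∀ k (v : Fin (k + 1) → ℝ), v ∈ Box γ k → extd v ∈ W)
    (hA : RepresentsA EA rA γ β) (hB : RepresentsB EBfam rB γ β)
    (h𝒜A : ∀ g' ∈ W, EA g' ∈ 𝒜A) (h𝒜B : ∀ b', 0 < b' → b' ≤ γ → ∀ g' ∈ W, EBfam b' g' ∈ 𝒜B)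
    (hr : ReadBoundedOn 𝒜A rA κ cr) (hcov : ReadCovariantOn 𝒜A 𝒜B rA rB κ cr) (hcr : 0 ≤ cr)
    -- ===== node U1/H3's runs, the rates and the window =====
    {ρ : ℝ} {g : ℕ → ℕ → ℝ} (gIR : ℝ) (hθ₅ρ : θ₅ ≤ ρ) (hνρ : ν < ρ) (hρ0 : 0 < ρ) (hρ1 : ρ < 1) (hγ : 0 ≤ γ)
    (hrun : ∀ K, RGEqH K β (g K)) (hbox : ∀ K i, i ≤ K → 0 < g K i ∧ g K i ≤ γ) (hpin : ∀ K, g K K = gIR)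
    (hsmall : cr * (ℓ / ν) * ν * (γ ^ 3 / 2) * (ρ / (ρ - ν)) ≤ (1 - ρ) / 2)
    (hgA : ∀ K, g K ∈ W) (hgB : ∀ K, (fun i => g (K + 1) (i + 1)) ∈ W)
    -- ===== node U1b, nodes U5/U6, the target rate =====
    {R : Readings ι X} {C₃ θ₃ P θ' : ℝ} {q : ℕ} {CU : (ℕ → ℝ) → ℕ → ℝ} {uA : ℕ → ι → C.BgA} {uB : ℕ → ι → C.BgB}
    (hU : LipBackground EA W κ CU) (hG : PolyLipGrowth CU g P q) (hP : 0 ≤ P)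
    (hloc : LocalRate R C₃ θ₃) (hC₃ : 0 ≤ C₃) (hθ₃ : 0 ≤ θ₃) (hθ₃1 : θ₃ < 1) (hgd : GaugeDominated R uA uB)
    (hθ' : max ν ρ < θ') (hθ₅' : θ₅ ≤ θ') (hθ₃' : θ₃ ≤ θ') :
    ∃ a : ℝ, 0 ≤ a ∧ ∀ K, URateUpTo K EA EB (g K) (fun i => g (K + 1) (i + 1)) (uA K) (uB K) R.dom
      (a + ℓ / ν * (γ ^ 3 * (2 * (cr * C₅ * θ₅) / (1 - ρ))) * (θ' / (θ' - max ν ρ)) + C₅) θ' κ := by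
  subst hδ₅
  have hθ₁1 : θ₁ ≤ 1 := hθ₁₅.trans hθ₅1
  exact uRateUpTo_of_endNE9_endNE5 G M Mf ρT expl h0 hAdm hres hadd hsum hstep hfac hclip0 hCup hqT0 hTcup hrepr hexpl
    hclipb hpexb hpexbar hqTb hKP hdec hpinB hρT hocc hB0 hlipb hτbar hω hpos hτ hℓ hν hrA hrB hbase hlip5 hdA hdB hent hunit
    hfl hr₀ hc₁
    (insertionRate_of_operatorRate M Ins hread hienv hbdA (operatorRate_of_entrywise_floor M hent hunit hfl hr₀ hc₁ hθ₁.le)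
      (div_nonneg hc₁ hr₀.le) hθ₁ hθ₁1 hρ₁ hreach)
    hdamp hrAf hrBf hbasef hlipf hdBf hentf hflf
    (fun b' hb hbγ => insertionRate_of_operatorRate (Mf b') (Insf b') (hreadf b' hb hbγ) (hienvf b' hb hbγ) (hbdAf b' hb hbγ)
      (operatorRate_of_entrywise_floor (Mf b') (hentf b' hb hbγ) hunit (hflf b' hb hbγ) hr₀ hc₁ hθ₁.le)
      (div_nonneg hc₁ hr₀.le) hθ₁ hθ₁1 hρ₁ hreach)
    hdampf hΛ₅ (insConst_nonneg hGi hc₁ hr₀ hρ₁ hθ₁) hθ₁.le hθ₁₅ hθ₅1 hc₅ hω₅ hnear hB₅ hfirst hsmall5 hC₅ hW hA hB h𝒜A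
    h𝒜B hr hcov hcr gIR hθ₅ρ hνρ hρ0 hρ1 hγ hrun hbox hpin hsmall hgA hgB hU hG hP hloc hC₃ hθ₃ hθ₃1 hgd hθ' hθ₅' hθ₃'

end Summit.QuantumFields.BalabanUV.T4Continuum.NE4ReadOutSocketInsertion
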